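import Summits.ResolutionOfSingularities.ResolutionOfSingularities.Theorems.ConeExit.Negative.Mirror
import HarnessLib
import Literature.AlgebraicGeometry.Resolution.PowerSeriesRegularLocal
import Literature.AlgebraicGeometry.Resolution.CohenMacaulaySystemsOfParameters

/-!
# `WildCones.ConeExit` (stmt-ResolutionOfSingularities-16883), line `critical-plane`: stub `stub_chern`

The CHERN / EULER–KOSZUL CRITICAL-DIRECTION LEMMA, the one deep input of the line `critical-plane`
(consumed by `stub_criticalPlane` at `dL = 2`); it is verbatim the route's support item
`WildCones.ChernCriticalDirection` (stmt-ResolutionOfSingularities-16885):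

for `p` an odd prime, `s ≥ 2` and `k` algebraically closed of characteristic `p`, every non-zero form
`H` of degree `p` in `k[y_1, …, y_s]` has a point `v ≠ 0` of `k^s` at which all partial derivatives
`∂_j H` vanish.

Proof (commutative algebra, no intersection theory). Suppose every `v ≠ 0` has some `∂_j H (v) ≠ 0`.
1. The partials `f_j = ∂_j H` are forms of degree `p - 1 ≥ 2` with only the origin as common zero, so by
   the Nullstellensatz (`MvPolynomial.vanishingIdeal_zeroLocus_eq_radical`) every variable lies in the
   radical of `(f_1, …, f_s)`; the same then holds for their images `g_j` in `S = k⟦y_1, …, y_s⟧`, so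
   `rad (g_1, …, g_s)` is the maximal ideal of `S`.
2. `S` is a regular local ring of dimension `s`
   (`Literature.AlgebraicGeometry.Resolution.isRegularLocalRing_mvPowerSeries_fin`), hence Cohen–Macaulay:
   the system of parameters `g_1, …, g_s` is a weakly regular sequence
   (`Literature.AlgebraicGeometry.Resolution.cmClause_of_isRegularLocalRing`, Matsumura 17.4 (iii) with
   17.8). In particular `g_s` is a non-zero-divisor modulo `(g_1, …, g_{s-1})`.
3. Euler's identity (`MvPolynomial.IsHomogeneous.sum_X_mul_pderiv`) reads `Σ y_j f_j = p · H = 0` in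
   characteristic `p`, so `y_s g_s ∈ (g_1, …, g_{s-1})`, whence `y_s ∈ (g_1, …, g_{s-1})`.
4. But every element of an ideal generated by series of order `≥ 2` has order `≥ 2`
   (`MvPowerSeries.le_order_mul`, `MvPowerSeries.min_order_le_add`), while `y_s` has order `1`:
   contradiction. (At `p = 2` step 4 breaks: the partials are linear; cf. the contact form `y_1 y_2` of
   `Theorems/ConeExit/Negative/ChernFalseAtTwo.lean`.)

Sources: H. Matsumura, *Commutative Ring Theory*, Thms. 17.4, 17.8 [Matsumura1987]; the statement is
the `c_{s-1}(Ω¹_{ℙ^{s-1}}(p)) ≠ 0` remark of the route card [Kollar2007].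
-/

noncomputable section

-- single-problem summit: the doubled namespace component `ResolutionOfSingularities` is forced
set_option linter.dupNamespace false

open Summit.ResolutionOfSingularities.ResolutionOfSingularities.Theorems.ConeExit.Negative
  (clean bl ord dv tr step ser pd jac cone Linv dL)
open scoped BigOperators

namespace Summit.ResolutionOfSingularities.ResolutionOfSingularities.Theorems.WildConesConeExit

/-- An ideal of `R⟦X⟧` generated by series of order `≥ n` consists of series of order `≥ n`.
[folklore] -/
theorem chern_le_order_of_mem_span {σ R : Type*} [CommRing R] (n : ℕ)
    (T : Set (MvPowerSeries σ R)) (hT : ∀ t ∈ T, (n : ℕ∞) ≤ t.order)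
    {x : MvPowerSeries σ R} (hx : x ∈ Ideal.span T) : (n : ℕ∞) ≤ x.order := by
  induction hx using Submodule.span_induction with
  | mem t ht => exact hT t ht
  | zero => simp
  | add a b _ _ ha hb => exact (le_min ha hb).trans MvPowerSeries.min_order_le_add
  | smul a b _ hb =>
    rw [smul_eq_mul]
    exact hb.trans (le_add_self.trans MvPowerSeries.le_order_mul)

/-- The variable `Xᵢ ∈ R⟦X⟧` has order `1` (`R` non-trivial). [folklore] -/
theorem chern_order_X {σ R : Type*} [CommRing R] [Nontrivial R] (i : σ) :
    (MvPowerSeries.X i : MvPowerSeries σ R).order = ((1 : ℕ) : ℕ∞) := by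
  rw [MvPowerSeries.X_def, MvPowerSeries.order_monomial_of_ne_zero one_ne_zero,
    Finsupp.degree_single]

/-- A variable does not lie in an ideal of `R⟦X⟧` generated by series of order `≥ 2`. [folklore] -/
theorem chern_X_not_mem_span {σ R : Type*} [CommRing R] [Nontrivial R]
    (T : Set (MvPowerSeries σ R)) (hT : ∀ t ∈ T, ((2 : ℕ) : ℕ∞) ≤ t.order) (i : σ) :
    (MvPowerSeries.X i : MvPowerSeries σ R) ∉ Ideal.span T := by
  intro hX
  have h := chern_le_order_of_mem_span 2 T hT hX
  rw [chern_order_X, ENat.coe_le_coe] at h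
  omega

/-- **Nullstellensatz step.** Over an algebraically closed field, if the polynomials of `T` have
no common zero other than the origin, then every variable lies in the radical of the ideal they
generate. [folklore] -/
theorem chern_X_mem_radical {k : Type} [Field k] [IsAlgClosed k] {σ : Type} [Finite σ]
    (T : Set (MvPolynomial σ k))
    (hT : ∀ x : σ → k, (∀ q ∈ T, MvPolynomial.eval x q = 0) → x = 0) (i : σ) :
    (MvPolynomial.X i : MvPolynomial σ k) ∈ (Ideal.span T).radical := by
  rw [← MvPolynomial.vanishingIdeal_zeroLocus_eq_radical (K := k),
    MvPolynomial.mem_vanishingIdeal_iff]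
  intro x hx
  rw [MvPolynomial.zeroLocus_span] at hx
  have hx0 : x = 0 := hT x fun q hq => by
    have h := hx q hq
    rwa [MvPolynomial.aeval_eq_eval] at h
  rw [MvPolynomial.aeval_X, hx0, Pi.zero_apply]

/-- **Koszul / Cohen–Macaulay step.** In `S = k⟦y_0, …, y_m⟧` there is no system of parameters
`g_0, …, g_m` (i.e. `rad (g) = 𝔪`) consisting of series of order `≥ 2` with `Σ y_j g_j = 0`:
such a system is a weakly regular sequence (`S` is regular, hence Cohen–Macaulay), so `g_m` is a
non-zero-divisor modulo `(g_0, …, g_{m-1}) ∋ y_m g_m`, forcing `y_m ∈ (g_0, …, g_{m-1})`, which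
the orders forbid. [cite: Matsumura1987, Thm. 17.4] -/
theorem chern_no_euler_sop {k : Type} [Field k] {m : ℕ}
    (g : Fin (m + 1) → MvPowerSeries (Fin (m + 1)) k)
    (hg2 : ∀ j, ((2 : ℕ) : ℕ∞) ≤ (g j).order)
    (hXg : ∀ i, (MvPowerSeries.X i : MvPowerSeries (Fin (m + 1)) k) ∈
      (Ideal.span (Set.range g)).radical)
    (heuler : ∑ j, (MvPowerSeries.X j : MvPowerSeries (Fin (m + 1)) k) * g j = 0) : False := by
  -- `rad (g) = 𝔪`
  have hgm : ∀ j, g j ∈ IsLocalRing.maximalIdeal (MvPowerSeries (Fin (m + 1)) k) := by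
    intro j
    rw [IsLocalRing.mem_maximalIdeal, mem_nonunits_iff, MvPowerSeries.isUnit_iff_constantCoeff,
      ← MvPowerSeries.coeff_zero_eq_constantCoeff_apply,
      MvPowerSeries.coeff_of_lt_order (by
        rw [map_zero]
        exact lt_of_lt_of_le (by exact_mod_cast Nat.zero_lt_two) (hg2 j)),
      isUnit_zero_iff]
    exact zero_ne_one
  have hJrad : (Ideal.span (Set.range g)).radical =
      IsLocalRing.maximalIdeal (MvPowerSeries (Fin (m + 1)) k) := by
    refine le_antisymm ?_ ?_
    · rw [(IsLocalRing.maximalIdeal.isMaximal _).isPrime.radical_le_iff, Ideal.span_le]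
      rintro _ ⟨j, rfl⟩
      exact hgm j
    · rw [Literature.AlgebraicGeometry.Resolution.maximalIdeal_mvPowerSeries_eq_span, Ideal.span_le]
      rintro _ ⟨i, rfl⟩
      exact hXg i
  have hJmax : (Ideal.span (Set.range g)).radical.IsMaximal := by
    rw [hJrad]
    exact IsLocalRing.maximalIdeal.isMaximal _
  -- Cohen–Macaulay: `g` is a weakly regular sequence
  obtain ⟨hRL, hdim⟩ :=
    Literature.AlgebraicGeometry.Resolution.isRegularLocalRing_mvPowerSeries_fin k (m + 1)
  have hwreg : RingTheory.Sequence.IsWeaklyRegular (MvPowerSeries (Fin (m + 1)) k) (List.ofFn g) :=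
    Literature.AlgebraicGeometry.Resolution.cmClause_of_isRegularLocalRing _ (m + 1) hdim g hJmax
  set rs₁ : List (MvPowerSeries (Fin (m + 1)) k) := List.ofFn (fun i : Fin m => g i.castSucc)
    with hrs₁
  rw [List.ofFn_succ_last, RingTheory.Sequence.isWeaklyRegular_append_iff,
    RingTheory.Sequence.isWeaklyRegular_singleton_iff] at hwreg
  obtain ⟨_, hreg⟩ := hwreg
  have hN : (Ideal.ofList rs₁ • ⊤ :
      Submodule (MvPowerSeries (Fin (m + 1)) k) (MvPowerSeries (Fin (m + 1)) k)) = Ideal.ofList rs₁ := by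
    rw [smul_eq_mul, Ideal.mul_top]
  -- Euler: `y_m g_m ∈ (g_0, …, g_{m-1})`
  have hmem : g (Fin.last m) * (MvPowerSeries.X (Fin.last m) : MvPowerSeries (Fin (m + 1)) k) ∈
      Ideal.ofList rs₁ := by
    rw [Fin.sum_univ_castSucc] at heuler
    rw [mul_comm, eq_neg_of_add_eq_zero_right heuler]
    refine neg_mem (Ideal.sum_mem _ fun i _ => Ideal.mul_mem_left _ _ (Ideal.subset_span ?_))
    show g i.castSucc ∈ rs₁
    rw [hrs₁, List.mem_ofFn]
    exact ⟨i, rfl⟩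
  -- hence `y_m ∈ (g_0, …, g_{m-1})`
  have hXmem : (MvPowerSeries.X (Fin.last m) : MvPowerSeries (Fin (m + 1)) k) ∈ Ideal.ofList rs₁ := by
    rw [← hN, ← Submodule.Quotient.mk_eq_zero]
    refine hreg ?_
    show g (Fin.last m) • Submodule.Quotient.mk _ =
      g (Fin.last m) • (0 : MvPowerSeries (Fin (m + 1)) k ⧸ (Ideal.ofList rs₁ • ⊤ :
        Submodule (MvPowerSeries (Fin (m + 1)) k) (MvPowerSeries (Fin (m + 1)) k)))
    rw [smul_zero, ← Submodule.Quotient.mk_smul, Submodule.Quotient.mk_eq_zero, hN, smul_eq_mul]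
    exact hmem
  -- contradiction with the orders
  refine chern_X_not_mem_span {r | r ∈ rs₁} ?_ (Fin.last m) hXmem
  intro t ht
  obtain ⟨i, rfl⟩ := List.mem_ofFn.mp ht
  exact hg2 _

/-- **STUB `stub_chern` (Chern / Euler–Koszul critical direction; = support item
`WildCones.ChernCriticalDirection`, stmt-ResolutionOfSingularities-16885).** For `p` an odd prime,
`s ≥ 2` and `k` algebraically closed of characteristic `p`, every non-zero form `H` of degree `p` in
`k[y_1, …, y_s]` has a non-zero point at which all the partial derivatives `∂_j H` vanish.
[cite: Matsumura1987, Thm. 17.4] -/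
theorem stub_chern : ∀ p : ℕ, p.Prime → p ≠ 2 → ∀ (s : ℕ), 2 ≤ s → ∀ (k : Type) [Field k] [CharP k p] [IsAlgClosed k] (H : MvPolynomial (Fin s) k), H.IsHomogeneous p → H ≠ 0 → ∃ v : Fin s → k, v ≠ 0 ∧ ∀ j : Fin s, MvPolynomial.eval v (MvPolynomial.pderiv j H) = 0 := by
  intro p hp hp2 s hs k _ _ _ H hH _
  have hp3 : 3 ≤ p := by
    have := hp.two_le
    omega
  obtain ⟨m, rfl⟩ : ∃ m, s = m + 1 := ⟨s - 1, by omega⟩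
  by_contra hcon
  push Not at hcon
  -- the partials: forms of degree `p - 1 ≥ 2` with only the origin as common zero
  have hfh : ∀ j : Fin (m + 1), (MvPolynomial.pderiv j H).IsHomogeneous (p - 1) := fun j => hH.pderiv
  have hT : ∀ x : Fin (m + 1) → k,
      (∀ q ∈ Set.range (fun j : Fin (m + 1) => MvPolynomial.pderiv j H), MvPolynomial.eval x q = 0) →
      x = 0 := by
    intro x hx
    by_contra hx0
    obtain ⟨j, hj⟩ := hcon x hx0
    exact hj (hx _ ⟨j, rfl⟩)
  -- Euler's identity in characteristic `p`
  have heulerP : ∑ j : Fin (m + 1), (MvPolynomial.X j) * MvPolynomial.pderiv j H = 0 := by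
    rw [hH.sum_X_mul_pderiv, nsmul_eq_mul, CharP.cast_eq_zero, zero_mul]
  -- pass to `S = k⟦y⟧`
  refine chern_no_euler_sop (k := k) (m := m)
    (fun j => ((MvPolynomial.pderiv j H : MvPolynomial (Fin (m + 1)) k) :
      MvPowerSeries (Fin (m + 1)) k)) ?_ ?_ ?_
  · -- orders `≥ 2`
    intro j
    refine MvPowerSeries.nat_le_order fun d hd => ?_
    rw [MvPolynomial.coeff_coe]
    exact (hfh j).coeff_eq_zero (by omega)
  · -- the variables lie in the radical
    intro i
    obtain ⟨N, hN⟩ := chern_X_mem_radical _ hT i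
    refine ⟨N, ?_⟩
    have h := Ideal.mem_map_of_mem (MvPolynomial.coeToMvPowerSeries.ringHom) hN
    rw [map_pow, MvPolynomial.coeToMvPowerSeries.ringHom_apply, MvPolynomial.coe_X, Ideal.map_span,
      ← Set.range_comp] at h
    exact h
  · -- Euler's identity, coerced
    have h := congrArg (MvPolynomial.coeToMvPowerSeries.ringHom (σ := Fin (m + 1)) (R := k)) heulerP
    rw [map_sum, map_zero] at h
    simpa only [map_mul, MvPolynomial.coeToMvPowerSeries.ringHom_apply, MvPolynomial.coe_X] using h

end Summit.ResolutionOfSingularities.ResolutionOfSingularities.Theorems.WildConesConeExit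

end
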